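import Literature.Topology.FourManifolds.BlowDownModelSphere
import Literature.Topology.FourManifolds.RadialSaturation
import HarnessLib

/-!
# Flattening charts of a knot defined on all of `ℝ³`

Infrastructure (theorems only) for the connected-sum decomposition of surgery on a split link
(`Literature.Topology.FourManifolds.exists_isSurgery_zeroFramedUnlink`, `KirbyCalculus.lean`).
A flattening chart `Φ₀` of a knot `K` (`Knot.FlatChart`, `BlowDownModelSphere.lean`: an injective
local diffeomorphism of an open neighbourhood `Ω` of the flat closed unit disc into `𝕊 3`
carrying the flat unit circle onto `K`) can be reparametrised to one **defined on all of `ℝ³`**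
whose image lies in any prescribed open set `W` containing the image of the flat disc: precompose
`Φ₀.Γ` with the round radial squash `v ↦ (R / √(‖v‖² + R² − 1)) v` of `ℝ³` onto the ball of
radius `R = √(1 + η/2)` (a diffeomorphism fixing the unit sphere, hence the flat circle;
`RadialSaturation.lean`) followed by the linear flattening `(x, y, z) ↦ (x, y, κ z)`, which
together map `ℝ³` into a box `N_η ⊆ Ω ∩ Φ₀⁻¹ W` around the flat disc
(`BlowDownFlat.exists_flatBox_subset`).

* `Knot.FlatChart.exists_flatChart_univ` — the global chart, `Φ.Ω = univ`, `range Φ.Γ ⊆ W`.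

Global charts make the flat-model tubular neighbourhoods (`Knot.FlatChart.ModelData.nbhd`,
framing `0` by `hasFraming_nbhd`) available around any disc-bounding knot inside any
neighbourhood of the disc, and let two such knots share the same flat data.

## References

* M. W. Hirsch, *Differential Topology* (1976), Ch. 4 §5 (tubular neighbourhoods).
* R. C. Kirby, *The Topology of 4-Manifolds*, LNM 1374 (1989), Ch. I §2.
-/

open scoped Manifold ContDiff Topology RealInnerProductSpace
open Set Function Metric Module Filter

noncomputable section

namespace Literature.Topology.FourManifolds

/-- Local notation: `𝔼 n` is the model Euclidean space `EuclideanSpace ℝ (Fin n)`. -/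
local notation "𝔼 " n:arg => EuclideanSpace ℝ (Fin n)

/-- Local notation: `𝕊 n` is the unit sphere in `EuclideanSpace ℝ (Fin (n + 1))`. -/
local notation "𝕊 " n:arg => (Metric.sphere (0 : EuclideanSpace ℝ (Fin (n + 1))) 1)

attribute [local instance] fact_finrank_euclideanSpace_two fact_finrank_euclideanSpace_four

open BlowDownFlat

/-! ### The round radial squash fixing the unit sphere -/

/-- The flat circle has norm `1`. [folklore] -/
theorem BlowDownFlat.norm_flatCircle (u : 𝕊 1) : ‖flatCircle u‖ = 1 := by
  have h := norm_sq_eq_three (flatCircle u)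
  have h0 : flatCircle u 0 = (u : 𝔼 2) 0 := rfl
  have h1 : flatCircle u 1 = (u : 𝔼 2) 1 := rfl
  have h2 : flatCircle u 2 = 0 := rfl
  rw [h0, h1, h2, sphere_sq u] at h
  nlinarith [norm_nonneg (flatCircle u)]

/-- **The round squash of `ℝ³` onto a ball, fixing the unit sphere.** For `c > 0` and
`R = √(1 + c)`, the radial map `v ↦ (R / √(‖v‖² + c)) • v` is an injective local diffeomorphism
of `ℝ³` (indeed a diffeomorphism onto the open ball of radius `R`) with image in that ball and
fixing every vector of norm `1`. [folklore] -/
theorem exists_roundSquash {c : ℝ} (hc : 0 < c) :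
    ∃ S : 𝔼 3 → 𝔼 3, Injective S ∧ (∀ v, IsLocalDiffeomorphAt 𝓘(ℝ, 𝔼 3) 𝓘(ℝ, 𝔼 3) ∞ S v) ∧
      (∀ v, ‖S v‖ < Real.sqrt (1 + c)) ∧ (∀ v, ‖v‖ = 1 → S v = v) ∧ ContDiff ℝ ∞ S := by
  set R : ℝ := Real.sqrt (1 + c) with hR
  have hR0 : 0 < R := Real.sqrt_pos.2 (by linarith)
  have hRsq : R ^ 2 = 1 + c := Real.sq_sqrt (by linarith)
  set φ : ℝ → ℝ := fun s ↦ R / Real.sqrt (s + c) with hφ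
  have hsc : ∀ s, 0 ≤ s → 0 < s + c := fun s hs ↦ by linarith
  have hφd : ∀ s, 0 ≤ s → HasDerivAt φ (-(R / (2 * ((s + c) * Real.sqrt (s + c))))) s := by
    intro s hs
    have h1 : HasDerivAt (fun s ↦ Real.sqrt (s + c)) (1 / (2 * Real.sqrt (s + c)) * 1) s :=
      (Real.hasDerivAt_sqrt (hsc s hs).ne').comp s ((hasDerivAt_id s).add_const c)
    have h2 := h1.inv (Real.sqrt_pos.2 (hsc s hs)).ne'
    have h3 := h2.const_mul R
    have hsq : Real.sqrt (s + c) ^ 2 = s + c := Real.sq_sqrt (hsc s hs).le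
    have hsqrt : 0 < Real.sqrt (s + c) := Real.sqrt_pos.2 (hsc s hs)
    have h4 : HasDerivAt (fun s ↦ R * (Real.sqrt (s + c))⁻¹)
        (-(R / (2 * ((s + c) * Real.sqrt (s + c))))) s := by
      refine h3.congr_deriv ?_
      rw [hsq]
      field_simp
    refine h4.congr_of_eventuallyEq (Filter.Eventually.of_forall fun x ↦ ?_)
    simp [hφ, div_eq_mul_inv]
  have hφs : ∀ s, 0 ≤ s → ContDiffAt ℝ ∞ φ s := fun s hs ↦ by
    have h1 : ContDiffAt ℝ ∞ (fun s ↦ Real.sqrt (s + c)) s :=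
      (Real.contDiffAt_sqrt (hsc s hs).ne').comp s (contDiffAt_id.add contDiffAt_const)
    exact contDiffAt_const.div h1 (Real.sqrt_pos.2 (hsc s hs)).ne'
  have hφpos : ∀ t, 0 ≤ t → 0 < φ (t ^ 2) := fun t _ ↦
    div_pos hR0 (Real.sqrt_pos.2 (hsc _ (sq_nonneg t)))
  have hder : ∀ t, 0 ≤ t → 0 < φ (t ^ 2) + 2 * t ^ 2 * deriv φ (t ^ 2) := by
    intro t ht
    rw [(hφd _ (sq_nonneg t)).deriv]
    have hpos : 0 < t ^ 2 + c := hsc _ (sq_nonneg t)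
    have hsqrt : 0 < Real.sqrt (t ^ 2 + c) := Real.sqrt_pos.2 hpos
    have hsq : Real.sqrt (t ^ 2 + c) ^ 2 = t ^ 2 + c := Real.sq_sqrt hpos.le
    have key : φ (t ^ 2) + 2 * t ^ 2 * -(R / (2 * ((t ^ 2 + c) * Real.sqrt (t ^ 2 + c)))) =
        R * c / ((t ^ 2 + c) * Real.sqrt (t ^ 2 + c)) := by
      simp only [hφ]
      field_simp
      linarith [hsq]
    rw [key]
    positivity
  obtain ⟨hinj, hsmooth, Φ, hΦf, hsrc, htgt, -, hsymm⟩ :=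
    exists_openPartialHomeomorph_radial (E := 𝔼 3) hφs hφpos hder
  refine ⟨fun v ↦ φ (‖v‖ ^ 2) • v, hinj, fun v ↦ ?_, fun v ↦ ?_, fun v hv ↦ ?_, hsmooth⟩
  · refine isLocalDiffeomorphAt_of_contDiffOn_openPartialHomeomorph Φ (by rw [hsrc]; trivial)
      (by rw [hΦf, hsrc]; exact hsmooth.contDiffOn) (by rw [htgt]; exact hsymm)
      (Filter.Eventually.of_forall fun w ↦ by rw [hΦf])
  · rw [norm_smul, Real.norm_eq_abs, abs_of_pos (hφpos _ (norm_nonneg v))]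
    simp only [hφ]
    have hpos : 0 < ‖v‖ ^ 2 + c := hsc _ (sq_nonneg _)
    have hsqrt : 0 < Real.sqrt (‖v‖ ^ 2 + c) := Real.sqrt_pos.2 hpos
    rw [div_mul_eq_mul_div, div_lt_iff₀ hsqrt]
    have hlt : ‖v‖ < Real.sqrt (‖v‖ ^ 2 + c) := by
      rw [Real.lt_sqrt (norm_nonneg v)]
      linarith
    nlinarith
  · simp only [hφ, hv, one_pow]
    have : Real.sqrt (1 + c) = R := rfl
    rw [this, div_self hR0.ne', one_smul]

/-! ### The linear flattening `(x, y, z) ↦ (x, y, κ z)` -/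

/-- **The linear flattening of the third coordinate**: for `κ ≠ 0` there is a continuous linear
automorphism `A` of `ℝ³` with `A p = (p₀, p₁, κ p₂)`. [folklore] -/
theorem exists_thirdCoordScaling {κ : ℝ} (hκ : κ ≠ 0) :
    ∃ A : 𝔼 3 ≃L[ℝ] 𝔼 3, ∀ p : 𝔼 3, A p 0 = p 0 ∧ A p 1 = p 1 ∧ A p 2 = κ * p 2 := by
  set e₂ : 𝔼 3 := EuclideanSpace.single 2 1 with he₂
  set L : 𝔼 3 →L[ℝ] 𝔼 3 :=
    ContinuousLinearMap.id ℝ (𝔼 3) + (κ - 1) • (EuclideanSpace.proj (2 : Fin 3)).smulRight e₂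
    with hL
  set L' : 𝔼 3 →L[ℝ] 𝔼 3 :=
    ContinuousLinearMap.id ℝ (𝔼 3) + (κ⁻¹ - 1) • (EuclideanSpace.proj (2 : Fin 3)).smulRight e₂
    with hL'
  have hLapp : ∀ (a : ℝ) (p : 𝔼 3) (i : Fin 3),
      ((ContinuousLinearMap.id ℝ (𝔼 3) +
        (a - 1) • (EuclideanSpace.proj (𝕜 := ℝ) (2 : Fin 3)).smulRight e₂ : 𝔼 3 →L[ℝ] 𝔼 3) p) i =
        if i = 2 then a * p 2 else p i := by
    intro a p i
    change (p + (a - 1) • (p 2 • e₂)) i = _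
    rw [he₂]
    fin_cases i
    · simp
    · simp
    · simp; ring
  have hcomp : ∀ (a b : ℝ) (p : 𝔼 3), a * b = 1 →
      (ContinuousLinearMap.id ℝ (𝔼 3) +
        (a - 1) • (EuclideanSpace.proj (𝕜 := ℝ) (2 : Fin 3)).smulRight e₂ : 𝔼 3 →L[ℝ] 𝔼 3)
        ((ContinuousLinearMap.id ℝ (𝔼 3) +
          (b - 1) • (EuclideanSpace.proj (𝕜 := ℝ) (2 : Fin 3)).smulRight e₂ : 𝔼 3 →L[ℝ] 𝔼 3) p) =
        p := by
    intro a b p hab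
    ext i
    rw [hLapp]
    by_cases hi : i = 2
    · subst hi
      rw [if_pos rfl, hLapp, if_pos rfl, ← mul_assoc, hab, one_mul]
    · rw [if_neg hi, hLapp, if_neg hi]
  refine ⟨ContinuousLinearEquiv.equivOfInverse L L' (fun p ↦ hcomp _ _ p (inv_mul_cancel₀ hκ))
    (fun p ↦ hcomp _ _ p (mul_inv_cancel₀ hκ)), fun p ↦ ?_⟩
  change L p 0 = p 0 ∧ L p 1 = p 1 ∧ L p 2 = κ * p 2
  rw [hL, hLapp, hLapp, hLapp]
  simp

/-! ### Global flattening charts -/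

/-- **A flattening chart defined on all of `ℝ³`, inside a prescribed neighbourhood of the disc.**
Let `Φ₀` be a flattening chart of the knot `K` and `W ⊆ 𝕊 3` an open set containing the image
`Φ₀.Γ '' flatDisc` of the flat closed unit disc. Then `K` has a flattening chart `Φ` with
`Φ.Ω = univ` and `range Φ.Γ ⊆ W`: `Φ.Γ = Φ₀.Γ ∘ A ∘ S` with `S` the round squash of `ℝ³` onto the
ball of radius `√(1 + η/2)` fixing the unit sphere and `A (x, y, z) = (x, y, κ z)`, which map
`ℝ³` into a box `N_η ⊆ Ω ∩ Φ₀⁻¹ W` (`BlowDownFlat.exists_flatBox_subset`); both fix the flat unit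
circle. (Hirsch (1976), Ch. 4 §5: tubular neighbourhoods of any radius.) [folklore] -/
theorem Knot.FlatChart.exists_flatChart_univ {K : Knot} (Φ₀ : K.FlatChart) {W : Set (𝕊 3)}
    (hW : IsOpen W) (hΦW : Φ₀.Γ '' BlowDownFlat.flatDisc ⊆ W) :
    ∃ Φ : K.FlatChart, Φ.Ω = univ ∧ range Φ.Γ ⊆ W ∧ range Φ.Γ ⊆ Φ₀.Γ '' Φ₀.Ω := by
  -- a box inside `Ω ∩ Φ₀⁻¹ W`
  set W' : Set (𝔼 3) := Φ₀.Ω ∩ Φ₀.Γ ⁻¹' W with hW'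
  have hopen : IsOpen W' := Φ₀.continuousOn.isOpen_inter_preimage Φ₀.isOpen_Ω hW
  have hsub : BlowDownFlat.flatDisc ⊆ W' := fun p hp ↦ ⟨Φ₀.flatDisc_subset hp, hΦW ⟨p, hp, rfl⟩⟩
  obtain ⟨η, hη, -, hbox⟩ := exists_flatBox_subset hopen hsub
  -- the round squash onto the ball of radius `R = √(1 + η/2)`
  have hc : 0 < η / 2 := by linarith
  obtain ⟨S, hSinj, hSloc, hSlt, hSfix, hSs⟩ := exists_roundSquash hc
  set R : ℝ := Real.sqrt (1 + η / 2) with hR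
  have hR0 : 0 < R := Real.sqrt_pos.2 (by linarith)
  have hRsq : R ^ 2 = 1 + η / 2 := Real.sq_sqrt (by linarith)
  -- the linear flattening
  set κ : ℝ := η / (2 * R) with hκ
  have hκ0 : 0 < κ := by positivity
  obtain ⟨A, hA⟩ := exists_thirdCoordScaling hκ0.ne'
  -- `A ∘ S` maps into the box
  have hmem : ∀ v, A (S v) ∈ flatBox η := by
    intro v
    obtain ⟨h0, h1, h2⟩ := hA (S v)
    have hn := hSlt v
    have hn2 : ‖S v‖ ^ 2 < 1 + η / 2 := by
      rw [← hRsq]; exact pow_lt_pow_left₀ hn (norm_nonneg _) two_ne_zero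
    have hsq := norm_sq_eq_three (S v)
    refine ⟨?_, ?_⟩
    · rw [h0, h1]; nlinarith [sq_nonneg (S v 2)]
    · rw [h2, abs_mul, abs_of_pos hκ0]
      have h3 : |S v 2| ≤ ‖S v‖ := by
        rw [← Real.sqrt_sq_eq_abs, ← Real.sqrt_sq (norm_nonneg (S v))]
        exact Real.sqrt_le_sqrt (by rw [hsq]; nlinarith [sq_nonneg (S v 0), sq_nonneg (S v 1)])
      have h4 : κ * |S v 2| ≤ κ * R := mul_le_mul_of_nonneg_left (h3.trans hn.le) hκ0.le
      have h5 : κ * R = η / 2 := by rw [hκ]; field_simp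
      linarith
  have hmemΩ : ∀ v, A (S v) ∈ Φ₀.Ω := fun v ↦ (hbox (hmem v)).1
  have hmemW : ∀ v, Φ₀.Γ (A (S v)) ∈ W := fun v ↦ (hbox (hmem v)).2
  -- both maps fix the flat circle
  have hfix : ∀ u : 𝕊 1, A (S (flatCircle u)) = flatCircle u := by
    intro u
    rw [hSfix _ (norm_flatCircle u)]
    obtain ⟨h0, h1, h2⟩ := hA (flatCircle u)
    have hz : flatCircle u 2 = 0 := rfl
    ext i
    fin_cases i
    · exact h0
    · exact h1
    · simp only [Fin.reduceFinMk]
      rw [h2, hz, mul_zero]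
  -- the chart
  refine ⟨⟨univ, isOpen_univ, fun v ↦ Φ₀.Γ (A (S v)), fun v _ ↦ ?_, fun v _ w _ h ↦ ?_,
    subset_univ _, fun u ↦ ?_⟩, rfl, ?_, ?_⟩
  · have h1 : IsLocalDiffeomorphAt 𝓘(ℝ, 𝔼 3) 𝓘(ℝ, 𝔼 3) ∞ (A ∘ S) v :=
      IsLocalDiffeomorphAt.comp (hf := hSloc v) (hg := A.toDiffeomorph.isLocalDiffeomorph _)
    exact IsLocalDiffeomorphAt.comp (hf := h1) (hg := Φ₀.isLocalDiffeomorphAt _ (hmemΩ v))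
  · exact hSinj (A.injective (Φ₀.injOn (hmemΩ v) (hmemΩ w) h))
  · rw [hfix, Φ₀.apply_flatCircle]
  · rintro _ ⟨v, rfl⟩
    exact hmemW v
  · rintro _ ⟨v, rfl⟩
    exact ⟨A (S v), hmemΩ v, rfl⟩

end Literature.Topology.FourManifolds
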